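import Mathlib.Tactic
import HarnessLib

/-!
# Sums of two cubes of integers (Cohen, Prop. 6.4.20)

H. Cohen, *Number Theory I* (GTM 239) [Cohen2007NumberTheoryI], §6.4.5, Proposition 6.4.20: *an integer
`n` is a sum of two cubes of (positive or negative) integers if and only if there exists a positive
divisor `d` of `n` such that `(4n/d − d²)/3` is the square of an integer. For example, a (positive)
prime `p` is a sum of two cubes of integers if and only if `p = 2` or `p = 3x² − 3x + 1` for some
`x ≥ 2`.* ("Proof. Left to the reader.") Everything here is a `theorem`. As printed the criterion is
meant for `n ≥ 1` (for `n = 0 = 1³ + (−1)³` no positive `d` works); we state it for `0 < n`: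
`d = x + y`, `n/d = x² − xy + y²`, `4n/d − d² = 3(x − y)²`, and conversely `x, y = (d ± e)/2`.
-/

namespace Literature.NumberTheory.DiophantineGeometry

namespace SumOfTwoCubes

/-- **Cohen, Prop. 6.4.20** (for `n ≥ 1`): `n = x³ + y³` with `x, y ∈ ℤ` iff some divisor `d > 0`
of `n` has `4(n/d) − d² = 3e²` for an integer `e`. [cite: Cohen2007NumberTheoryI, Prop. 6.4.20] -/
theorem cohen_prop_6_4_20 {n : ℤ} (hn : 0 < n) :
    (∃ x y : ℤ, x ^ 3 + y ^ 3 = n) ↔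
      ∃ d e : ℤ, 0 < d ∧ d ∣ n ∧ 4 * (n / d) - d ^ 2 = 3 * e ^ 2 := by
  constructor
  · rintro ⟨x, y, h⟩
    have hfac : n = (x + y) * (x ^ 2 - x * y + y ^ 2) := by rw [← h]; ring
    have hq : 0 < x ^ 2 - x * y + y ^ 2 := by
      rcases eq_or_ne x 0 with rfl | hx
      · rcases eq_or_ne y 0 with rfl | hy
        · simp at h; omega
        · nlinarith [sq_pos_of_ne_zero hy]
      · nlinarith [sq_nonneg (x - y), sq_nonneg (x + y), sq_pos_of_ne_zero hx]
    have hd : 0 < x + y := by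
      by_contra hle
      rw [not_lt] at hle
      have : (x + y) * (x ^ 2 - x * y + y ^ 2) ≤ 0 := mul_nonpos_of_nonpos_of_nonneg hle hq.le
      omega
    refine ⟨x + y, x - y, hd, ⟨_, hfac⟩, ?_⟩
    have hdiv : n / (x + y) = x ^ 2 - x * y + y ^ 2 := by
      rw [hfac, mul_comm, Int.mul_ediv_cancel _ hd.ne']
    rw [hdiv]; ring
  · rintro ⟨d, e, hd, ⟨c, hc⟩, h⟩
    have hcd : n / d = c := by rw [hc, mul_comm, Int.mul_ediv_cancel _ hd.ne']
    rw [hcd] at h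
    -- `d` and `e` have the same parity (`d² + 3e² = 4c`)
    obtain ⟨x, hx⟩ : (2 : ℤ) ∣ d + e := by
      have h4 : (4 : ℤ) ∣ d ^ 2 + 3 * e ^ 2 := ⟨c, by linarith⟩
      rcases Int.even_or_odd d with ⟨a, ha⟩ | ⟨a, ha⟩ <;> rcases Int.even_or_odd e with ⟨b, hb⟩ | ⟨b, hb⟩
      · exact ⟨a + b, by rw [ha, hb]; ring⟩
      · exfalso
        rw [ha, hb] at h4
        have : (4 : ℤ) ∣ (a + a) ^ 2 + 3 * (2 * b + 1) ^ 2 - 4 * (a ^ 2 + 3 * b ^ 2 + 3 * b) :=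
          dvd_sub h4 (dvd_mul_right 4 _)
        have e2 : (a + a) ^ 2 + 3 * (2 * b + 1) ^ 2 - 4 * (a ^ 2 + 3 * b ^ 2 + 3 * b) = 3 := by ring
        rw [e2] at this; norm_num at this
      · exfalso
        rw [ha, hb] at h4
        have : (4 : ℤ) ∣ (2 * a + 1) ^ 2 + 3 * (b + b) ^ 2 - 4 * (a ^ 2 + a + 3 * b ^ 2) :=
          dvd_sub h4 (dvd_mul_right 4 _)
        have e2 : (2 * a + 1) ^ 2 + 3 * (b + b) ^ 2 - 4 * (a ^ 2 + a + 3 * b ^ 2) = 1 := by ring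
        rw [e2] at this; norm_num at this
      · exact ⟨a + b + 1, by rw [ha, hb]; ring⟩
    -- `x = (d + e)/2`, `y = (d − e)/2 = d − x`
    refine ⟨x, d - x, ?_⟩
    have he : e = 2 * x - d := by linarith
    rw [he] at h
    have e1 : x ^ 3 + (d - x) ^ 3 = d * (d ^ 2 - 3 * x * (d - x)) := by ring
    rw [e1, hc]
    have e2 : d ^ 2 - 3 * x * (d - x) = c := by nlinarith
    rw [e2]

/-- **Cohen, Prop. 6.4.20, example:** a positive prime `p` is a sum of two cubes of integers iff
`p = 2` or `p = 3x² − 3x + 1` for some integer `x ≥ 2`. [cite: Cohen2007NumberTheoryI, Prop. 6.4.20] -/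
theorem prime_sum_two_cubes {p : ℕ} (hp : p.Prime) :
    (∃ x y : ℤ, x ^ 3 + y ^ 3 = p) ↔ p = 2 ∨ ∃ x : ℤ, 2 ≤ x ∧ (p : ℤ) = 3 * x ^ 2 - 3 * x + 1 := by
  have hp0 : (0 : ℤ) < p := by exact_mod_cast hp.pos
  rw [cohen_prop_6_4_20 hp0]
  constructor
  · rintro ⟨d, e, hd, hdp, h⟩
    have hd' : d.natAbs ∣ p := Int.natAbs_dvd_natAbs.mpr hdp |>.trans (by simp)
    rcases (Nat.dvd_prime hp).mp hd' with h1 | h1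
    · -- `d = 1`: `3e² = 4p − 1`, `e = 2x − 1`, `p = 3x² − 3x + 1`
      have hd1 : d = 1 := by omega
      subst hd1
      have h1' : (p : ℤ) / 1 = p := by simp
      rw [h1', one_pow] at h
      right
      have heo : Odd e := by
        rcases Int.even_or_odd e with ⟨k, hk⟩ | he
        · exfalso
          rw [hk] at h
          have : (4 : ℤ) ∣ 1 := ⟨p - 3 * k ^ 2, by linarith⟩
          norm_num at this
        · exact he
      -- choose the sign of `e` so that `x = (|e| + 1)/2 ≥ 2`... use `x = (e + 1)/2` or `(1 - e)/2`
      obtain ⟨k, hk⟩ := heo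
      rcases le_or_gt 0 k with hk0 | hk0
      · refine ⟨k + 1, ?_, ?_⟩
        · -- `k ≥ 1` since `p ≥ 2` forces `e² ≥ …`; `k = 0` gives `p = 1`
          by_contra hlt
          have hk0' : k = 0 := by omega
          subst hk0'
          have he1 : e = 1 := by omega
          subst he1
          have hp1 : (p : ℤ) = 1 := by linarith
          have := hp.one_lt
          omega
        · nlinarith
      · refine ⟨-k, ?_, ?_⟩
        · by_contra hlt
          have hk1 : k = -1 := by omega
          subst hk1
          have he1 : e = -1 := by omega
          subst he1
          have hp1 : (p : ℤ) = 1 := by linarith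
          have := hp.one_lt
          omega
        · nlinarith
    · -- `d = p`: `3e² = 4 − p²`, so `p = 2`
      have hdp' : d = p := by omega
      subst hdp'
      have h1' : (p : ℤ) / p = 1 := Int.ediv_self hp0.ne'
      rw [h1'] at h
      left
      have : (p : ℤ) ^ 2 ≤ 4 := by nlinarith [sq_nonneg e]
      have hp2 : (p : ℤ) ≤ 2 := by nlinarith
      have := hp.two_le
      omega
  · rintro (rfl | ⟨x, hx, h⟩)
    · exact ⟨2, 0, by norm_num, by norm_num, by norm_num⟩
    · refine ⟨1, 2 * x - 1, by norm_num, one_dvd _, ?_⟩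
      rw [Int.ediv_one, h]; ring

/-- The two cubes in the prime case: `3x² − 3x + 1 = x³ + (1 − x)³` and `2 = 1³ + 1³`.
[cite: Cohen2007NumberTheoryI, Prop. 6.4.20] -/
theorem centered_hexagonal_eq_cubes (x : ℤ) : 3 * x ^ 2 - 3 * x + 1 = x ^ 3 + (1 - x) ^ 3 := by ring

end SumOfTwoCubes

end Literature.NumberTheory.DiophantineGeometry
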